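import Summits.BirchSwinnertonDyer.Rank1Residual.Additive.TwistPartnerForcedOfDelbourgo
import HarnessLib

/-!
# The E-normalised tame branch on defect 3, 4, 6 EXISTS (from Delbourgo 1998 Theorem 1): the
# binder of the tame-branch main conjecture and of the Kato half is INHABITED, and the Kato half holds
# non-vacuously (cell `b2b-bsdres`, sub-cell additive-p2 = X3♯(G-ord)/X4♯(G-ord), gen 25)

HONEST FRAMING (cell `b2b-bsdres`, run/shared/lean/b2b/bsd-rank1-residual/, verbatim in every
file): the goal of the cell is to DELETE the COMBINATION-SHAPED residual classes of the
Birch–Swinnerton-Dyer formula for ALL analytic-rank `≤ 1` elliptic curves over `ℚ` — "full BSD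
formula for every rank `≤ 1` curve in class `C`" assembled STRICTLY from published theorems — so
that the rank-`≤ 1` remainder becomes exactly the CONSTRUCTION-SHAPED classes, which are TYPED
(missing-input `Prop`s), NOT attempted. This is not "finishing BSD". Sub-cell additive-p2: the
classes X3♯(G-ord) / X4♯(G-ord) are CONSTRUCTION-SHAPED and stay so; labels / RESIDUAL-MAP marks
UNCHANGED; nothing is booked. Theorems only; named facts enter as hypothesis binders
(`Delbourgo1998.thm1_exists_bounded_evenMeasure`, `Delbourgo2002.thmC_charIdeal_dvd_tameBranch`,
`….mainTheorem`, `….mainTheorem_potMult`). No definition, no `sorry`.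

## What

cc-typer-2's interpolation package `IsTameBranchOf f p ε α B` (`TameBranchLower.lean`) is the binder of
the cell's tame-branch main conjecture `TameBranchRatCharEqAt`, of the typed Kato half
`TameBranchRatDvdAt` and of the named facts A175/A227 — all UNIVERSALLY quantified over `(ε, α, B)`;
its docstring records "VACUITY PASS: the premise IS inhabited for the true tuple by MTT §I + Delbourgo
1998 Thm. 1 — in print in pieces, NOT a tree fact", and on defect 3/4/6 the tuple was delivered only
by the census-typed `OrdinaryTwistPartnerAt` (`exists_isTameBranchOf_of_ordinaryTwistPartnerAt`). With
Delbourgo 1998 Theorem 1 now a NAMED FACT (gen 25) the tuple is delivered FROM PRINT: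

* **`exists_isTameBranchOf_of_thm1`**: on the (G)-ordinary additive locus at `p ≥ 5` with defect
  `e ∈ {3,4,6}`, for the newform `f` of `E = W`: `∃ χ₀` (`orderOf (ι∘χ₀) = tameDefect W p`), `∃ ã₀` unit,
  `∃ B`, `IsTameBranchOf f p (ι∘χ₀) ã₀ B`, with the integrality transfer `‖[Tʲ]B‖ ≤ C` for every tower
  bound `C` of the plus symbols (so `B ∈ ℤ_p⟦T⟧` on X4, `plusSymbolsPIntegralAt_of_classX4`).
* **`exists_charIdeal_dvd_tameBranch_of_thm1`**: the typed Kato half `TameBranchRatDvdAt W p` is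
  therefore NON-VACUOUS: for an actual tame branch `B`, `X(E/ℚ_∞)` is torsion and
  `ι g = p^k·B` for some `g ∈ char_Λ X(E/ℚ_∞)`; discharged by A227 in
  **`ClassX4Gord.exists_integral_tameBranch_dvd_of_thm1_of_thmC`** (X4: `B` integral) — Delbourgo
  1998 Thm 1 + 2002 (A)(C), no per-pair input at all: on every X4♯(G-ord) pair of defect 3/4/6 at
  `p ≥ 5` (non-CM) there is an INTEGRAL power series `B ∈ ℤ_p⟦T⟧`, interpolating `E`'s own twisted
  plus symbols, with `λ(char_Λ X(E/ℚ_∞)) ≤ λ`-content of `p^k B` — the rational Kato bound, inhabited.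
Nothing booked; the LOWER half and everything else of `ENDSTATE §3` unchanged.

References: D. Delbourgo, Compositio Math. 113 (1998) Thm. 1 [Delbourgo1998]; J. Number Theory 95
(2002) Thm. (A), (C) [Delbourgo2002]; B. Mazur, J. Tate, J. Teitelbaum, Invent. Math. 84 (1986)
§I.10–I.14 [MazurTateTeitelbaum1986Invent].
-/

noncomputable section

open scoped Classical MatrixGroups ModularForm NumberField

open CongruenceSubgroup IsDedekindDomain WeierstrassCurve NumberField
  Literature.NumberTheory.EllipticCurves
  Literature.NumberTheory.EllipticCurves.ModularForms
  Literature.NumberTheory.EllipticCurves.Rank1Residual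
  Literature.NumberTheory.EllipticCurves.Rank1Residual.Typed
  Literature.NumberTheory.EllipticCurves.Delbourgo2002

namespace Summit.BirchSwinnertonDyer.Rank1Residual.Additive

namespace TwistPartner

section Branch

variable {W : WeierstrassCurve ℚ} [W.IsElliptic] [W.IsGloballyMinimal] {p : ℕ} [hp : Fact p.Prime]
  {N : ℕ} [NeZero N] {f : CuspForm (Gamma0 N) 2}

/-- **THE E-NORMALISED TAME BRANCH EXISTS, FROM PRINT.** On the (G)-ordinary ADDITIVE locus at `p ≥ 5`
with defect `e = semistabilityIndex W p ∈ {3, 4, 6}`, for the newform `f` of `E = W`: Delbourgo 1998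
Theorem 1 (named fact) gives a character `χ₀` of `ℤ/p` with `orderOf (ι ∘ χ₀) = tameDefect W p`, a unit
`ã₀`, and a power series `B ∈ ℚ_p⟦T⟧` with `IsTameBranchOf f p (ι∘χ₀) ã₀ B` — the binder of
`TameBranchRatCharEqAt` / `TameBranchRatDvdAt` / A175 / A227 is INHABITED — together with the integrality
transfer `‖[Tʲ]B‖ ≤ C` for every tower bound `C` of the plus symbols `[a/pⁿ]⁺_f`. (The Mellin transform of
the forced partner's measure, which is tower-bounded by `exists_towerBounded_forced_of_thm1`.)
[cite: Delbourgo1998, Theorem 1 (p. 131)] [cite: MazurTateTeitelbaum1986Invent, §I.10, §I.13–I.14] -/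
theorem exists_isTameBranchOf_of_thm1 (hD : Delbourgo1998.thm1_exists_bounded_evenMeasure)
    (h5 : 5 ≤ p) (hadd : Addv W p) (hGord : TypeGOrd W p)
    (he : semistabilityIndex W p ∈ ({3, 4, 6} : Finset ℕ)) (hf : IsNewformOf W f) :
    ∃ (χ₀ : MulChar (ZMod p) ℚ_[p]) (ã₀ : ℚ_[p]) (B : PowerSeries ℚ_[p]),
      orderOf (χ₀.ringHomComp (algebraMap ℚ_[p] ℂ_[p])) = tameDefect W p ∧ ‖ã₀‖ = 1 ∧
      IsTameBranchOf f p (χ₀.ringHomComp (algebraMap ℚ_[p] ℂ_[p])) ã₀ B ∧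
      ∀ C : ℝ, (∀ (n : ℕ) (a : ℤ), ‖((ratPlusSymbol f ((a : ℚ) / (p : ℚ) ^ n) : ℚ) : ℚ_[p])‖ ≤ C) →
        ∀ j : ℕ, ‖PowerSeries.coeff j B‖ ≤ C := by
  obtain ⟨χ₀, ã₀, hord, hã, -, C₀, hC₀⟩ := exists_towerBounded_forced_of_thm1 hD h5 hadd hGord he hf
  have hp2 : p ≠ 2 := by omega
  have hG : SubGord W p := (subGord_iff_typeG_of_addv W p hp2 hadd).mpr hGord.typeG
  have hne : χ₀ ≠ 1 := by
    intro h
    rw [h, orderOf_one] at hord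
    simp only [Finset.mem_insert, Finset.mem_singleton] at he
    omega
  have hU0 := sum_ratPlusSymbol_add_div_eq_zero_of_addv W hf hadd
  set RS : ℕ → ℕ → ℚ_[p] := fun k n ↦
      ∑ᶠ ξ : rootsOfUnity (Literature.NumberTheory.EllipticCurves.torsionOrder p) ℤ_[p],
        ∑ s : ZMod (p ^ n),
        twistPartnerMeasure χ₀
            (TwistPartner.forced χ₀ (fun r ↦ ((ratPlusSymbol f r : ℚ) : ℚ_[p])) ã₀) ã₀
            ((ratPlusSymbol f 0 : ℚ) : ℚ_[p]) (n + cyclotomicExponent p)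
            (PadicInt.toZModPow (n + cyclotomicExponent p) ((ξ : ℤ_[p]ˣ) : ℤ_[p]) *
              (cyclotomicGenerator p : ZMod (p ^ (n + cyclotomicExponent p))) ^ s.val) *
          ((s.val.choose k : ℕ) : ℚ_[p]) with hRSdef
  obtain ⟨B, hB, hint, -⟩ :=
    exists_isTameBranchOf_riemannSum_of_towerBounded_forced (RS := RS) (fun _ _ ↦ rfl) hne hã hU0 hC₀
  refine ⟨χ₀, ã₀, B, ?_, hã, hB, hint⟩
  rw [orderOf_ringHomComp_padicComplex, hord, tameDefect_of_not_potMult W p hG.1]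

/-- **THE TYPED KATO HALF IS NON-VACUOUS.** On the same locus, with the cyclotomic data `κ, γ`: the
typed rational Kato divisibility `TameBranchRatDvdAt W p` (∀-quantified over the branch) applies to an
ACTUAL branch: `∃ χ₀ ã₀ B` with `IsTameBranchOf f p (ι∘χ₀) ã₀ B` such that for every Pontryagin-dual
datum `D` of `Sel_{p^∞}(E/ℚ_∞)`, `X` is `Λ`-torsion and `ι g = p^k·B` for some `g ∈ char_Λ X`, `k ∈ ℕ`.
[cite: Delbourgo1998, Theorem 1 (p. 131)] [cite: Delbourgo2002, Theorem (C) (p. 40)] -/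
theorem exists_charIdeal_dvd_tameBranch_of_thm1 (hD : Delbourgo1998.thm1_exists_bounded_evenMeasure)
    (hT : TameBranchRatDvdAt W p) (h5 : 5 ≤ p) (hadd : Addv W p) (hGord : TypeGOrd W p)
    (he : semistabilityIndex W p ∈ ({3, 4, 6} : Finset ℕ)) (hf : IsNewformOf W f)
    {κ : ZpExtension ℚ p} {γ : Field.absoluteGaloisGroup ℚ} (hκ : κ.IsCyclotomic)
    (hγ : κ.IsTopGenerator γ) (hcv : IsCyclotomicVariable p γ) :
    ∃ (χ₀ : MulChar (ZMod p) ℚ_[p]) (ã₀ : ℚ_[p]) (B : PowerSeries ℚ_[p]),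
      ‖ã₀‖ = 1 ∧ IsTameBranchOf f p (χ₀.ringHomComp (algebraMap ℚ_[p] ℂ_[p])) ã₀ B ∧
      (∀ C : ℝ, (∀ (n : ℕ) (a : ℤ), ‖((ratPlusSymbol f ((a : ℚ) / (p : ℚ) ^ n) : ℚ) : ℚ_[p])‖ ≤ C) →
        ∀ j : ℕ, ‖PowerSeries.coeff j B‖ ≤ C) ∧
      ∀ D : W.SelmerDualData κ γ,
        D.IsTorsion ∧ ∃ g ∈ D.charIdeal, ∃ k : ℕ,
          iwasawaToPowerSeries p g = PowerSeries.C ((p : ℚ_[p]) ^ k) * B := by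
  obtain ⟨χ₀, ã₀, B, hord, hã, hB, hint⟩ := exists_isTameBranchOf_of_thm1 hD h5 hadd hGord he hf
  have hp2 : p ≠ 2 := by omega
  exact ⟨χ₀, ã₀, B, hã, hB, hint,
    fun D ↦ hT _ ã₀ B hp2 hadd (Or.inr hGord) hκ hγ hcv hf hord hã hB D⟩

/-- **X4♯(G-ord), defect 3, 4, 6, `p ≥ 5`, non-CM — AN INTEGRAL TAME BRANCH DIVIDED BY THE CHARACTERISTIC
IDEAL, FROM PRINTED FACTS ONLY** (Delbourgo 1998 Thm 1; Delbourgo 2002 (A), (C); Drinfeld–Manin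
integrality on X4): for the newform `f` and the cyclotomic data there are `χ₀`, a unit `ã₀` and an
INTEGRAL `B` (`‖[Tʲ]B‖ ≤ 1`) interpolating `E`'s own `χ₀`-twisted plus symbols (`IsTameBranchOf`) with
`X(E/ℚ_∞)` torsion and `ι g = p^k·B`, `g ∈ char_Λ X(E/ℚ_∞)` — NO per-pair input. Nothing booked.
[cite: Delbourgo1998, Theorem 1 (p. 131)] [cite: Delbourgo2002, Theorem (A), (C) (p. 40)]
[cite: Manin1972, Cor. 3.6] -/
theorem ClassX4Gord.exists_integral_tameBranch_dvd_of_thm1_of_thmC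
    (hD : Delbourgo1998.thm1_exists_bounded_evenMeasure)
    (hC : Delbourgo2002.thmC_charIdeal_dvd_tameBranch) (hDel : Delbourgo2002.mainTheorem)
    (hDelM : Delbourgo2002.mainTheorem_potMult) (hX : ClassX4Gord W p) (h5 : 5 ≤ p) (hcm : ¬ W.HasCM)
    (he : semistabilityIndex W p ∈ ({3, 4, 6} : Finset ℕ)) (hf : IsNewformOf W f)
    {κ : ZpExtension ℚ p} {γ : Field.absoluteGaloisGroup ℚ} (hκ : κ.IsCyclotomic)
    (hγ : κ.IsTopGenerator γ) (hcv : IsCyclotomicVariable p γ) :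
    ∃ (χ₀ : MulChar (ZMod p) ℚ_[p]) (ã₀ : ℚ_[p]) (B : PowerSeries ℚ_[p]),
      ‖ã₀‖ = 1 ∧ IsTameBranchOf f p (χ₀.ringHomComp (algebraMap ℚ_[p] ℂ_[p])) ã₀ B ∧
      (∀ j : ℕ, ‖PowerSeries.coeff j B‖ ≤ 1) ∧
      ∀ D : W.SelmerDualData κ γ,
        D.IsTorsion ∧ ∃ g ∈ D.charIdeal, ∃ k : ℕ,
          iwasawaToPowerSeries p g = PowerSeries.C ((p : ℚ_[p]) ^ k) * B := by
  have hT : TameBranchRatDvdAt W p := tameBranchRatDvdAt_of_thmC hC hDel hDelM h5 hcm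
  obtain ⟨χ₀, ã₀, B, hã, hB, hint, hdvd⟩ :=
    exists_charIdeal_dvd_tameBranch_of_thm1 hD hT h5 hX.addv.2 hX.typeGOrd he hf hκ hγ hcv
  have h1 : ∀ j : ℕ, ‖PowerSeries.coeff j B‖ ≤ 1 :=
    hint 1 fun n a ↦ plusSymbolsPIntegralAt_of_classX4 W p hX.1 f hf _
  exact ⟨χ₀, ã₀, B, hã, hB, h1, hdvd⟩

end Branch

/-! ### Appendix (same gen): the rank-one VALUATION IDENTITY from print + finite data (X4♯(G-ord)) -/

section JoinIdentity

variable {W : WeierstrassCurve ℚ} [W.IsElliptic] [W.IsGloballyMinimal] {p : ℕ} [hp : Fact p.Prime]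
  {N : ℕ} [NeZero N] {f : CuspForm (Gamma0 N) 2} {χ : MulChar (ZMod p) ℚ_[p]} {ã : ℚ_[p]}
  {RS : ℕ → ℕ → ℚ_[p]}
  (hRS : ∀ k n : ℕ, RS k n =
      ∑ᶠ ξ : rootsOfUnity (Literature.NumberTheory.EllipticCurves.torsionOrder p) ℤ_[p],
        ∑ s : ZMod (p ^ n),
        twistPartnerMeasure χ
            (TwistPartner.forced χ (fun r ↦ ((ratPlusSymbol f r : ℚ) : ℚ_[p])) ã) ã
            ((ratPlusSymbol f 0 : ℚ) : ℚ_[p]) (n + cyclotomicExponent p)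
            (PadicInt.toZModPow (n + cyclotomicExponent p) ((ξ : ℤ_[p]ˣ) : ℤ_[p]) *
              (cyclotomicGenerator p : ZMod (p ^ (n + cyclotomicExponent p))) ^ s.val) *
          ((s.val.choose k : ℕ) : ℚ_[p]))

include hRS

/-- **X4♯(G-ord), defect 3, 4, 6, `rank E(ℚ) = 1`, `p ≥ 5`, non-CM — THE VALUATION IDENTITY from
printed facts (Delbourgo 1998 Thm 1; Delbourgo 2002 (A), (C); Drinfeld–Manin on X4) and the three
finite per-pair data (unit root `ã` of `X² − a_w(E_F)X + p`; SIGN certificate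
`1 < ‖forced χ⁻¹ [·]⁺_f ã (a₀/p^{n₀})‖`; ONE unit Riemann sum `‖RS 1 n‖ = 1`):** for every (B)-datum `Dh`
and every Pontryagin-dual datum with `char = (fE)`: Schneider, `#Ш[p^∞] < ∞`, `λ(fE) = 1`, and
`ord Ш[p^∞] + ord Reg_p(Dh) + ord ∏c + ord ℓ = μ(fE) + 1 + 2 ord #E(ℚ)_tors`, `ℓ ∣ p²`, `ℓ = 1` off the
anomalous rows — gen 24's `padicVal_identity_rankOne_…_forcedRiemannSum` with its boundedness
hypothesis DISCHARGED from print. Nothing booked.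
[cite: Delbourgo1998, Theorem 1 (p. 131)] [cite: Delbourgo2002, Theorem (A), (B), (C) (p. 40)] [cite: Manin1972, Cor. 3.6] -/
theorem ClassX4Gord.padicVal_identity_rankOne_of_thm1_of_signCert_of_riemannSum
    (hD : Delbourgo1998.thm1_exists_bounded_evenMeasure)
    (hC : Delbourgo2002.thmC_charIdeal_dvd_tameBranch) (hDel : Delbourgo2002.mainTheorem)
    (hDelM : Delbourgo2002.mainTheorem_potMult) (hX : ClassX4Gord W p) (h5 : 5 ≤ p) (hcm : ¬ W.HasCM)
    (he : semistabilityIndex W p ∈ ({3, 4, 6} : Finset ℕ)) (hrk : W.mordellWeilRank = 1)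
    (hf : IsNewformOf W f)
    {L : Type} [Field L] [NumberField L] [IsCyclotomicExtension {p} ℚ L] (F : IntermediateField ℚ L)
    (hF : ∀ w : HeightOneSpectrum (𝓞 F), (p : 𝓞 F) ∈ w.asIdeal →
      (W.baseChange F).HasGoodReductionAt w ∧ (W.baseChange F).HasUnitRootAt w)
    (w : HeightOneSpectrum (𝓞 F)) (hw : (p : 𝓞 F) ∈ w.asIdeal)
    (hã : ‖ã‖ = 1) (hroot : ã ^ 2 - (((W.baseChange F).frobeniusTraceAt w : ℤ) : ℚ_[p]) * ã + p = 0)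
    (hχe : orderOf χ = semistabilityIndex W p)
    (hsign : ∃ (n₀ : ℕ) (a₀ : ℤ),
      1 < ‖TwistPartner.forced χ⁻¹ (fun r ↦ ((ratPlusSymbol f r : ℚ) : ℚ_[p])) ã
        ((a₀ : ℚ) / (p : ℚ) ^ n₀)‖)
    {n : ℕ} (hn : 1 ≤ n) (hunit : ‖RS 1 n‖ = 1)
    {Dh : PAdicHeightData W p} (hBcl : LeadingTermClauses W p Dh)
    {κ : ZpExtension ℚ p} {γ : Field.absoluteGaloisGroup ℚ}
    (hκ : κ.IsCyclotomic) (hγ : κ.IsTopGenerator γ) (hcv : IsCyclotomicVariable p γ)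
    (D : W.SelmerDualData κ γ) [Module.Finite (IwasawaAlgebra p) D.X]
    {fE : IwasawaAlgebra p} (hchar : D.charIdeal = Ideal.span {fE}) :
    SchneiderConjecture Dh ∧ Finite (AddCommGroup.primaryComponent W.sha p) ∧
      X1.MuLambda.lam fE = 1 ∧
      ∃ ℓ : ℕ, ℓ ∣ p ^ 2 ∧ (ReductionNonAnomalous W p → ℓ = 1) ∧
        (padicValNat p (Nat.card (AddCommGroup.primaryComponent W.sha p)) : ℤ) +
            (padicRegulator Dh).valuation + padicValNat p W.tamagawaProduct + padicValNat p ℓ =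
          X1.MuLambda.mu fE + 1 + 2 * padicValNat p W.torsionOrder := by
  have hp2 : p ≠ 2 := by omega
  have hadd : Addv W p := hX.addv.2
  have hGord : TypeGOrd W p := hX.typeGOrd
  have hG : SubGord W p := (subGord_iff_typeG_of_addv W p hp2 hadd).mpr hGord.typeG
  have hc : ∀ (m : ℕ) (a : ℤ),
      ‖((ratPlusSymbol f ((a : ℚ) / (p : ℚ) ^ m) : ℚ) : ℚ_[p])‖ ≤ (p : ℝ) ^ (0 : ℕ) := fun m a ↦ by
    rw [pow_zero]
    exact plusSymbolsPIntegralAt_of_classX4 W p hX.1 f hf _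
  have hsign' : ∃ (n₀ : ℕ) (a₀ : ℤ), (p : ℝ) ^ (0 : ℕ) <
      ‖TwistPartner.forced χ⁻¹ (fun r ↦ ((ratPlusSymbol f r : ℚ) : ℚ_[p])) ã
        ((a₀ : ℚ) / (p : ℚ) ^ n₀)‖ := by
    obtain ⟨n₀, a₀, h⟩ := hsign; exact ⟨n₀, a₀, by rwa [pow_zero]⟩
  obtain ⟨C₀, hC₀⟩ := TwistPartner.towerBounded_forced_of_thm1_of_signCert hD h5 hadd he hf F hF w hw
    hã hroot hχe hc hsign'
  have hne : χ ≠ 1 := by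
    intro h
    rw [h, orderOf_one] at hχe
    simp only [Finset.mem_insert, Finset.mem_singleton] at he
    omega
  have hU0 := sum_ratPlusSymbol_add_div_eq_zero_of_addv W hf hadd
  have hT : TameBranchRatDvdAt W p := tameBranchRatDvdAt_of_thmC hC hDel hDelM h5 hcm
  obtain ⟨B, hB, hint, -⟩ :=
    exists_isTameBranchOf_riemannSum_of_towerBounded_forced hRS hne hã hU0 hC₀
  have hord : orderOf (χ.ringHomComp (algebraMap ℚ_[p] ℂ_[p])) = tameDefect W p := by
    rw [orderOf_ringHomComp_padicComplex, hχe, tameDefect_of_not_potMult W p hG.1]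
  have hint1 : ∀ j : ℕ, ‖PowerSeries.coeff j B‖ ≤ 1 := fun j ↦ by
    have h := hint _ hc j
    rwa [pow_zero] at h
  have hunit' : ‖PowerSeries.coeff 1 B‖ = 1 := by
    have h := hB.norm_coeff_eq_pow_of_forcedRiemannSum_tower hRS hne hã hU0 hC₀ hc (k := 1) (n := n)
      (by omega) hn (by rw [pow_zero]; exact hunit)
    rwa [pow_zero] at h
  have h := padicVal_identity_of_tameBranchRatDvdAt_of_cert hT hp2 hadd (Or.inr hGord) hf hord hã hB
    hint1 ⟨1, by rw [hrk], hunit'⟩ hBcl hκ hγ hcv D hchar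
  rw [hrk] at h
  obtain ⟨hS, hfin, hlam, ℓ, hℓ, hna, hid⟩ := h
  exact ⟨hS, hfin, hlam, ℓ, hℓ, hna, by exact_mod_cast hid⟩

end JoinIdentity

end TwistPartner

end Summit.BirchSwinnertonDyer.Rank1Residual.Additive

end
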